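import Summits.KontsevichZagierPeriods.KontsevichZagierPeriods.Theorems.LinRedNormalFormArrangementNormalFormStubRebaseSimplePosOneFibreParCells
import Summits.KontsevichZagierPeriods.KontsevichZagierPeriods.Theorems.LinRedNormalFormArrangementNormalFormStubRebaseSimplePosOneFibreParLevel

/-!
# Stub `stub_rebaseSimplePosOneZero`, residual hypothesis `Hpar` (crux `ArrangementNormalForm`,
line `janus-bands`, v10) — sub-part `ParOne`: `Hpar` over a base of dimension `2`

**The residual hypothesis `Hpar` of the one-fibre rebase, in full, for `B = 1`** (base
`(x, y)` in a bounded rational polygon, one fibre `t` with letter `0` and affine bounds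
`0 < u < v` PARALLEL in `y`, base factor `p(x)/∏ Lⱼ(x)^{eⱼ} · 1/(y − ℓ₂(x))`):
`RebasePos.good_par_one`, registered as `rebaseSimplePos_par_one` with exactly the text of the
hypothesis `Hpar` of `rebaseSimplePos_oneFibre_of_double'` at `b = 0`, target
`closure (GGset 1 2 1)`. Proof: dissect the polygon into PRODUCT cells (vertical trapezoids
`{x-rows} × (ylo(x), yhi(x))`, `rebaseSimplePos_par_cells`); on a trapezoid the height
`h = yhi − ylo` and the width `w = v − u` are affine functions of the single silent coordinate
`x`, positive on the cell, so that (`RebasePos.good_parCell_one`, registered separately as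
`rebaseSimplePos_par_cell_one`) either `h` is constant (non-pinching:
`rebaseSimplePos_par_nonpinch`), or `w = c' h + d'` identically and
* `d' > 0` (the width does not vanish at the pinch `h = 0`): cut at `h = δ'` (rule 1a); the
  far part `h > δ'` is non-pinching, the near part satisfies `|s₀| h ≤ (N+1) w` for an explicit
  `N` (level splits, `rebaseSimplePos_par_level`);
* `d' = 0` (width and height vanish together — the corner left open by the unfold–exchange
  chain): `|s₀| h ≤ (N+1) w` on the WHOLE cell with `N ≥ |s₀|/c'` (level splits), or the cell is
  empty (`c' ≤ 0`);
* `d' < 0`: cut at the zero `h = −d'/c'` of the width; the far part is non-pinching, the near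
  part is empty.
No convergence estimate is involved beyond those of `rebaseSimplePos_par_nonpinch`.

References: M. Kontsevich, D. Zagier, *Periods* (2001), §1.2, rules (1a), (2).
-/

noncomputable section

open Set MeasureTheory MvPolynomial
open Literature.NumberTheory.Transcendental Literature.ModelTheory.ExponentialFields

namespace Summit.KontsevichZagierPeriods.ArrangementNormalForm.JanusBands

namespace RebasePos

open SeparatePos

section One

variable {B m m' m₀ : ℕ}

/-- Strict rows of an extended `x'`-row family. -/
theorem rowsB_snoc_iff {M₀ : Fin m₀ → (Fin B → ℚ) × ℚ} {d : (Fin B → ℚ) × ℚ}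
    {z : Fin (B + 1 + 1) → ℝ} :
    (∀ j, 0 < affB B 1 ((Fin.snoc M₀ d : Fin (m₀ + 1) → _) j) z) ↔
      (∀ j, 0 < affB B 1 (M₀ j) z) ∧ 0 < affB B 1 d z := by
  simp only [Fin.forall_fin_succ', Fin.snoc_castSucc, Fin.snoc_last]

/-- Strict rows of an extended full-base row family. -/
theorem rowsF_snoc_iff {M : Fin m' → (Fin (B + 1) → ℚ) × ℚ} {h : (Fin (B + 1) → ℚ) × ℚ}
    {z : Fin (B + 1 + 1) → ℝ} :
    (∀ j, 0 < affF B 1 ((Fin.snoc M h : Fin (m' + 1) → _) j) z) ↔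
      (∀ j, 0 < affF B 1 (M j) z) ∧ 0 < affF B 1 h z := by
  simp only [Fin.forall_fin_succ', Fin.snoc_castSucc, Fin.snoc_last]

/-- An `x`-form over a base of dimension `2` is an affine function of the single silent
coordinate `x`. -/
theorem affB_one (d : (Fin 1 → ℚ) × ℚ) (z : Fin (1 + 1 + 1) → ℝ) :
    affB 1 1 d z = (d.1 0 : ℝ) * z (Fin.castAdd 1 (Fin.castSucc 0)) + d.2 := by
  simp [affB]

variable (L : Fin m → (Fin 1 → ℚ) × ℚ) (e : Fin m → ℕ) (ℓ₁ ℓ₂ : (Fin 1 → ℚ) × ℚ)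

/-- **`Hpar` over ONE product cell of a base of dimension `2`.** See the module docstring. -/
theorem good_parCell_one (s : KZ.IntegralRep (1 + 1 + 1)) (M : Fin m' → (Fin (1 + 1) → ℚ) × ℚ)
    (M₀ : Fin m₀ → (Fin 1 → ℚ) × ℚ) (ylo yhi : (Fin 1 → ℚ) × ℚ) (p : MvPolynomial (Fin 1) ℚ)
    (u v : (Fin (1 + 1) → ℚ) × ℚ) (hbd : Bornology.IsBounded s.domain)
    (hdom : s.domain = gDom 1 1 m' M (fun _ => Sum.inr u) (fun _ => Sum.inr v))
    (hint : EqOn s.integrand (glit 1 1 p L e ℓ₁ ℓ₂ 0 1 (fun _ => some 0)) s.domain)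
    (hu : u.1 (Fin.last 1) ≠ 0) (hpar : u.1 (Fin.last 1) = v.1 (Fin.last 1))
    (hcell : ∀ z : Fin (1 + 1 + 1) → ℝ, (∀ j, 0 < affF 1 1 (M j) z) →
      0 < affF 1 1 u z ∧ affF 1 1 u z < affF 1 1 v z)
    (hsec : ∀ z : Fin (1 + 1 + 1) → ℝ, (∀ j, 0 < affF 1 1 (M j) z) ↔ ((∀ j, 0 < affB 1 1 (M₀ j) z) ∧
      affB 1 1 ylo z < z (Fin.castAdd 1 (Fin.last 1)) ∧ z (Fin.castAdd 1 (Fin.last 1)) < affB 1 1 yhi z)) :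
    ∃ c ∈ AddSubgroup.closure (GGset 1 2 1), KZ.of s - c ∈ KZ.relations := by
  -- height and width as affine functions of `x`
  set s₀ : ℚ := u.1 (Fin.last 1) with hs₀
  set hF : (Fin 1 → ℚ) × ℚ := yhi - ylo with hhF
  set wF : (Fin 1 → ℚ) × ℚ := restr 1 v - restr 1 u with hwF
  set a : ℚ := hF.1 0 with ha
  set b : ℚ := hF.2 with hb
  have hhz : ∀ z : Fin (1 + 1 + 1) → ℝ, affB 1 1 hF z = affB 1 1 yhi z - affB 1 1 ylo z :=
    fun z => by rw [hhF, affB_sub]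
  have hwz : ∀ z : Fin (1 + 1 + 1) → ℝ, affB 1 1 wF z = affF 1 1 v z - affF 1 1 u z :=
    fun z => by rw [hwF, affB_sub, width_eq u v hpar]
  have hha : ∀ z : Fin (1 + 1 + 1) → ℝ, affB 1 1 hF z = (a : ℝ) * z (Fin.castAdd 1 (Fin.castSucc 0)) + b :=
    fun z => by rw [affB_one]
  -- on the base cell the height and the width are positive
  have hpos : ∀ z : Fin (1 + 1 + 1) → ℝ, (∀ j, 0 < affF 1 1 (M j) z) →
      0 < affB 1 1 hF z ∧ 0 < affB 1 1 wF z := fun z hz => by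
    obtain ⟨-, hlo, hhi⟩ := (hsec z).1 hz
    obtain ⟨-, huv⟩ := hcell z hz
    rw [hhz, hwz]
    exact ⟨by linarith, by linarith⟩
  -- an empty base cell
  have hempty : (∀ z : Fin (1 + 1 + 1) → ℝ, ¬ (∀ j, 0 < affF 1 1 (M j) z)) →
      ∃ c ∈ AddSubgroup.closure (GGset 1 2 1), KZ.of s - c ∈ KZ.relations := fun h => by
    refine good_of_null s ?_
    rw [hdom]
    exact measure_mono_null (fun z hz => (h z ((mem_gDom_one M u v z).1 hz).1).elim) measure_empty
  -- the non-pinching case with an explicit `η`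
  have hNP : ∀ η : ℝ, 0 < η → (∀ z : Fin (1 + 1 + 1) → ℝ, (∀ j, 0 < affB 1 1 (M₀ j) z) → η ≤ affB 1 1 hF z) →
      ∃ c ∈ AddSubgroup.closure (GGset 1 2 1), KZ.of s - c ∈ KZ.relations := fun η hη h =>
    good_parNonpinch' L e ℓ₁ ℓ₂ s M M₀ ylo yhi p u v hbd hdom hint hu hpar hcell hsec
      ⟨η, hη, fun z hz => by rw [← hhz]; exact h z hz⟩
  -- constant height
  by_cases ha0 : a = 0
  · have hconst : ∀ z : Fin (1 + 1 + 1) → ℝ, affB 1 1 hF z = b := fun z => by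
      rw [hha, ha0]; push_cast; ring
    by_cases hb0 : b ≤ 0
    · refine hempty fun z hz => ?_
      have h := (hpos z hz).1
      rw [hconst] at h
      have : (b : ℝ) ≤ 0 := by exact_mod_cast hb0
      linarith
    · push Not at hb0
      exact hNP b (by exact_mod_cast hb0) fun z _ => (hconst z).ge
  -- `w = c' h + d'`
  set c' : ℚ := wF.1 0 / a with hc'
  set d' : ℚ := wF.2 - c' * b with hd'
  have hwh : ∀ z : Fin (1 + 1 + 1) → ℝ, affB 1 1 wF z = (c' : ℝ) * affB 1 1 hF z + d' := fun z => by
    rw [affB_one wF, hha, hd', hc']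
    have ha' : (a : ℝ) ≠ 0 := by exact_mod_cast ha0
    push_cast
    field_simp
    ring
  -- the cut at a level `h = δ` (rule 1a): the far part `h > δ` is non-pinching
  have hcut : ∀ δ : ℚ, 0 < δ →
      (∀ s₂ : KZ.IntegralRep (1 + 1 + 1), s₂.domain ⊆ s.domain → s₂.integrand = s.integrand →
        s₂.domain = gDom 1 1 (m' + 1) (Fin.snoc M (-(((Fin.snoc (hF - ((0 : Fin 1 → ℚ), δ)).1 0 :
          Fin (1 + 1) → ℚ), (hF - ((0 : Fin 1 → ℚ), δ)).2) : (Fin (1 + 1) → ℚ) × ℚ)))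
          (fun _ => Sum.inr u) (fun _ => Sum.inr v) →
        (∀ z ∈ s₂.domain, (∀ j, 0 < affF 1 1 (M j) z) ∧ affB 1 1 hF z < δ) →
        ∃ c ∈ AddSubgroup.closure (GGset 1 2 1), KZ.of s₂ - c ∈ KZ.relations) →
      ∃ c ∈ AddSubgroup.closure (GGset 1 2 1), KZ.of s - c ∈ KZ.relations := by
    intro δ hδ hlow
    set g : (Fin (1 + 1) → ℚ) × ℚ := (((Fin.snoc (hF - ((0 : Fin 1 → ℚ), δ)).1 0 : Fin (1 + 1) → ℚ),
      (hF - ((0 : Fin 1 → ℚ), δ)).2) : (Fin (1 + 1) → ℚ) × ℚ) with hg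
    have hgz : ∀ z : Fin (1 + 1 + 1) → ℝ, affF 1 1 g z = affB 1 1 hF z - δ := fun z => by
      rw [hg, affF_liftB, affB_sub, affB_const]
    have hgne : g ≠ 0 := by
      refine liftB_ne_zero fun h0 => ha0 ?_
      have := congrArg (fun d : (Fin 1 → ℚ) × ℚ => d.1 0) h0
      simpa [ha] using this
    obtain ⟨s₁, s₂, hm₁, hm₂, hi₁, hi₂, hd₁, hd₂, hrel⟩ := cutBase s M _ _ hdom g hgne
    have hsub₁ : s₁.domain ⊆ s.domain := fun z hz => ((hm₁ z).1 hz).1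
    have hsub₂ : s₂.domain ⊆ s.domain := fun z hz => ((hm₂ z).1 hz).1
    refine good_of_split hrel ?_ (hlow s₂ hsub₂ hi₂ hd₂ fun z hz => ?_)
    · -- far part: non-pinching with `η = δ`
      refine good_parNonpinch' L e ℓ₁ ℓ₂ s₁ (Fin.snoc M g) (Fin.snoc M₀ (hF - ((0 : Fin 1 → ℚ), δ)))
        ylo yhi p u v (hbd.subset hsub₁) hd₁ (by rw [hi₁]; exact hint.mono hsub₁) hu hpar
        (fun z hz => hcell z (rows_snoc hz).1) (fun z => ?_) ⟨δ, by exact_mod_cast hδ, fun z hz => ?_⟩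
      · rw [rowsF_snoc_iff, rowsB_snoc_iff, hsec, hgz, affB_sub hF, affB_const]
        constructor
        · rintro ⟨⟨h0, hlo, hhi⟩, hgt⟩
          exact ⟨⟨h0, by linarith⟩, hlo, hhi⟩
        · rintro ⟨⟨h0, hgt⟩, hlo, hhi⟩
          exact ⟨⟨h0, hlo, hhi⟩, by linarith⟩
      · have h := (rowsB_snoc_iff.1 hz).2
        rw [affB_sub hF, affB_const, hhz] at h
        linarith
    · -- near part: handed back
      have hz' : z ∈ s₂.domain := hz
      rw [hd₂, mem_gDom_one] at hz'
      obtain ⟨hM, hneg⟩ := rows_snoc hz'.1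
      rw [affF_neg', hgz] at hneg
      exact ⟨hM, by linarith⟩
  -- case analysis on the width at the pinch
  rcases lt_trichotomy d' 0 with hd'0 | hd'0 | hd'0
  · -- `d' < 0`
    by_cases hc'0 : c' ≤ 0
    · refine hempty fun z hz => ?_
      obtain ⟨hh, hw⟩ := hpos z hz
      rw [hwh] at hw
      have e1 : (c' : ℝ) * affB 1 1 hF z ≤ 0 :=
        mul_nonpos_of_nonpos_of_nonneg (by exact_mod_cast hc'0) hh.le
      have e2 : (d' : ℝ) < 0 := by exact_mod_cast hd'0
      linarith
    · push Not at hc'0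
      -- cut at the zero `h = −d'/c'` of the width; the near part is empty
      have hw0 : 0 < -d' / c' := div_pos (by linarith) hc'0
      refine hcut (-d' / c') hw0 fun s₂ _ _ _ hz₂ => good_of_null s₂ ?_
      refine measure_mono_null (fun z hz => ?_) measure_empty
      obtain ⟨hM, hlt⟩ := hz₂ z hz
      obtain ⟨-, hw⟩ := hpos z hM
      rw [hwh] at hw
      have hc : (0 : ℝ) < c' := by exact_mod_cast hc'0
      have hlt' : affB 1 1 hF z < ((-d' / c' : ℚ) : ℝ) := hlt
      push_cast at hlt'
      rw [lt_div_iff₀ hc] at hlt'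
      simp only [mem_empty_iff_false]
      linarith
  · -- `d' = 0`: width and height vanish together
    by_cases hc'0 : c' ≤ 0
    · refine hempty fun z hz => ?_
      obtain ⟨hh, hw⟩ := hpos z hz
      rw [hwh, hd'0] at hw
      have e1 : (c' : ℝ) * affB 1 1 hF z ≤ 0 :=
        mul_nonpos_of_nonpos_of_nonneg (by exact_mod_cast hc'0) hh.le
      push_cast at hw
      linarith
    · push Not at hc'0
      -- level splits on the whole cell with `N ≥ |s₀|/c'`
      set N : ℕ := ⌈|s₀| / c'⌉₊ with hN
      have hNq : |s₀| ≤ (N : ℚ) * c' := by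
        have h := Nat.le_ceil (|s₀| / c')
        rw [← hN, div_le_iff₀ hc'0] at h
        exact h
      have hNr : |(s₀ : ℝ)| ≤ (N : ℝ) * c' := by exact_mod_cast hNq
      refine good_parLevel L e ℓ₁ ℓ₂ 0 1 M₀ yhi p u v (Or.inl rfl) hpar N s M ylo hbd hdom hint
        (fun z hz => (hsec z).1 hz) fun z hz => ?_
      obtain ⟨hh, hw⟩ := hpos z hz
      rw [← hhz, ← hwz, hwh, hd'0, Rat.cast_zero, add_zero]
      have e1 : |(s₀ : ℝ)| * affB 1 1 hF z ≤ (N : ℝ) * c' * affB 1 1 hF z :=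
        mul_le_mul_of_nonneg_right hNr hh.le
      have e2 : (0 : ℝ) ≤ c' * affB 1 1 hF z := by
        rw [hwh, hd'0, Rat.cast_zero, add_zero] at hw
        exact hw.le
      calc |(s₀ : ℝ)| * affB 1 1 hF z ≤ (N : ℝ) * c' * affB 1 1 hF z := e1
        _ ≤ ((N : ℝ) + 1) * ((c' : ℝ) * affB 1 1 hF z) := by nlinarith [e2]
  · -- `d' > 0`: cut at `h = δ'`, near part by level splits, far part non-pinching
    set δ' : ℚ := if 0 ≤ c' then 1 else -d' / (2 * c') with hδ'
    have hδ'0 : 0 < δ' := by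
      rw [hδ']
      split_ifs with h
      · exact one_pos
      · push Not at h
        exact div_pos_of_neg_of_neg (by linarith) (by linarith)
    set wmin : ℚ := min d' (c' * δ' + d') with hwmin
    have hwmin0 : 0 < wmin := by
      rw [hwmin, lt_min_iff]
      refine ⟨hd'0, ?_⟩
      rw [hδ']
      split_ifs with h
      · nlinarith
      · push Not at h
        have hc : c' ≠ 0 := h.ne
        have : c' * (-d' / (2 * c')) = -d' / 2 := by field_simp
        rw [this]
        linarith
    -- the width is at least `wmin` where `0 < h < δ'`
    have hwlow : ∀ z : Fin (1 + 1 + 1) → ℝ, 0 < affB 1 1 hF z → affB 1 1 hF z < δ' →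
        (wmin : ℝ) ≤ affB 1 1 wF z := by
      intro z h0 h1
      rw [hwh]
      have hm1 : (wmin : ℝ) ≤ d' := by exact_mod_cast min_le_left _ _
      have hm2 : (wmin : ℝ) ≤ c' * δ' + d' := by exact_mod_cast min_le_right _ _
      by_cases hc : 0 ≤ c'
      · have : (0 : ℝ) ≤ c' * affB 1 1 hF z := mul_nonneg (by exact_mod_cast hc) h0.le
        linarith
      · push Not at hc
        have hc' : (c' : ℝ) < 0 := by exact_mod_cast hc
        have : (c' : ℝ) * δ' < c' * affB 1 1 hF z := mul_lt_mul_of_neg_left h1 hc'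
        linarith
    set N : ℕ := ⌈|s₀| * δ' / wmin⌉₊ with hN
    have hNq : |s₀| * δ' ≤ (N : ℚ) * wmin := by
      have h := Nat.le_ceil (|s₀| * δ' / wmin)
      rw [← hN, div_le_iff₀ hwmin0] at h
      exact h
    have hNr : |(s₀ : ℝ)| * δ' ≤ (N : ℝ) * wmin := by exact_mod_cast hNq
    refine hcut δ' hδ'0 fun s₂ hsub₂ hi₂ hd₂ hz₂ => ?_
    refine good_parLevel L e ℓ₁ ℓ₂ 0 1 M₀ yhi p u v (Or.inl rfl) hpar N s₂ _ ylo (hbd.subset hsub₂)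
      hd₂ (by rw [hi₂]; exact hint.mono hsub₂) (fun z hz => (hsec z).1 (rows_snoc hz).1) fun z hz => ?_
    obtain ⟨hM, -⟩ := rows_snoc hz
    obtain ⟨hh, hw⟩ := hpos z hM
    -- `h < δ'` on the near part: from the extra row
    have hlt : affB 1 1 hF z < δ' := by
      have h2 := (rowsF_snoc_iff.1 hz).2
      rw [affF_neg', affF_liftB, affB_sub hF, affB_const] at h2
      linarith
    have hwm := hwlow z hh hlt
    rw [← hhz, ← hwz]
    have e1 : |(s₀ : ℝ)| * affB 1 1 hF z ≤ |(s₀ : ℝ)| * δ' :=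
      mul_le_mul_of_nonneg_left hlt.le (abs_nonneg _)
    have e2 : (N : ℝ) * wmin ≤ N * affB 1 1 wF z := mul_le_mul_of_nonneg_left hwm (Nat.cast_nonneg N)
    nlinarith

/-- **The residual hypothesis `Hpar` over a base of dimension `2`** (exactly the text of `Hpar`
in `rebaseSimplePos_oneFibre_of_double'` at `b = 0`). See the module docstring. -/
theorem good_par_one (s : KZ.IntegralRep (1 + 1 + 1)) (M : Fin m' → (Fin (1 + 1) → ℚ) × ℚ)
    (p : MvPolynomial (Fin 1) ℚ) (u v : (Fin (1 + 1) → ℚ) × ℚ) (hbd : Bornology.IsBounded s.domain)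
    (hdom : s.domain = gDom 1 1 m' M (fun _ => Sum.inr u) (fun _ => Sum.inr v))
    (hint : EqOn s.integrand (glit 1 1 p L e ℓ₁ ℓ₂ 0 1 (fun _ => some 0)) s.domain)
    (hu : u.1 (Fin.last 1) ≠ 0) (hpar : u.1 (Fin.last 1) = v.1 (Fin.last 1))
    (hcell : ∀ z : Fin (1 + 1 + 1) → ℝ, (∀ j, 0 < affF 1 1 (M j) z) →
      0 < affF 1 1 u z ∧ affF 1 1 u z < affF 1 1 v z) :
    ∃ c ∈ AddSubgroup.closure (GGset 1 2 1), KZ.of s - c ∈ KZ.relations :=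
  par_cells s M u v hbd hdom fun _ _ s' M' M₀ ylo yhi hsub hi' hd' hsec hbase =>
    good_parCell_one L e ℓ₁ ℓ₂ s' M' M₀ ylo yhi p u v (hbd.subset hsub) hd'
      (by rw [hi']; exact hint.mono hsub) hu hpar (fun z hz => hcell z (hbase z hz)) hsec

end One

end RebasePos

/-- **Registered part of `stub_rebaseSimplePosOneZero`, residual hypothesis `Hpar` (line
`janus-bands`, v10): `Hpar` over ONE PRODUCT CELL of a base of dimension `2`.** The data of
`Hpar` at `B = 1` (one lettered fibre over the base `(x, y)`, letter `0`, affine bounds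
`0 < u < v` parallel in `y` with common slope `s₀ ≠ 0`, base pole of order one) over a base
cell which is a PRODUCT `{x-rows M₀} × (ylo(x), yhi(x))` (`hsec`): `[s]` is congruent modulo
`KZ.relations` to the subgroup generated by the literal class `GG 1 2 1`
(`RebasePos.good_parCell_one`: height `h = yhi − ylo` and width `w = v − u` are affine in `x`
and positive on the cell; constant `h` is non-pinching (`rebaseSimplePos_par_nonpinch`);
otherwise `w = c' h + d'` and one cut at a level of `h` (rule 1a) separates a non-pinching far
part from a near part on which `|s₀| h ≤ (N + 1) w` (`rebaseSimplePos_par_level`) or which is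
empty). -/
theorem rebaseSimplePos_par_cell_one (m m' m₀ : ℕ) (s : KZ.IntegralRep (1 + 1 + 1)) (M : Fin m' → (Fin (1 + 1) → ℚ) × ℚ) (M₀ : Fin m₀ → (Fin 1 → ℚ) × ℚ) (ylo yhi : (Fin 1 → ℚ) × ℚ) (L : Fin m → (Fin 1 → ℚ) × ℚ) (e : Fin m → ℕ) (p : MvPolynomial (Fin 1) ℚ) (ℓ₁ ℓ₂ : (Fin 1 → ℚ) × ℚ) (u v : (Fin (1 + 1) → ℚ) × ℚ) (hbd : Bornology.IsBounded s.domain) (hdom : s.domain = SeparatePos.gDom 1 1 m' M (fun _ => Sum.inr u) (fun _ => Sum.inr v)) (hint : Set.EqOn s.integrand (RebasePos.glit 1 1 p L e ℓ₁ ℓ₂ 0 1 (fun _ => some 0)) s.domain) (hu : u.1 (Fin.last 1) ≠ 0) (hpar : u.1 (Fin.last 1) = v.1 (Fin.last 1)) (hcell : ∀ z : Fin (1 + 1 + 1) → ℝ, (∀ j, 0 < SeparatePos.affF 1 1 (M j) z) → 0 < SeparatePos.affF 1 1 u z ∧ SeparatePos.affF 1 1 u z < SeparatePos.affF 1 1 v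 z) (hsec : ∀ z : Fin (1 + 1 + 1) → ℝ, (∀ j, 0 < SeparatePos.affF 1 1 (M j) z) ↔ ((∀ j, 0 < SeparatePos.affB 1 1 (M₀ j) z) ∧ SeparatePos.affB 1 1 ylo z < z (Fin.castAdd 1 (Fin.last 1)) ∧ z (Fin.castAdd 1 (Fin.last 1)) < SeparatePos.affB 1 1 yhi z)) : ∃ c ∈ AddSubgroup.closure (SeparatePos.GGset 1 2 1), KZ.of s - c ∈ KZ.relations :=
  RebasePos.good_parCell_one L e ℓ₁ ℓ₂ s M M₀ ylo yhi p u v hbd hdom hint hu hpar hcell hsec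

/-- **Registered part of `stub_rebaseSimplePosOneZero` (line `janus-bands`, v10): the residual
hypothesis `Hpar` of the one-fibre rebase over a base of dimension `2`, IN FULL** — exactly the
text of the hypothesis `Hpar` of `rebaseSimplePos_oneFibre_of_double'` at `b = 0`: for every
one-fibre literal datum over a bounded polygonal base cell in `(x, y)` with letter `0`, affine
bounds `0 < u < v` PARALLEL in `y` (common slope `≠ 0`) and base factor
`p(x)/∏ Lⱼ(x)^{eⱼ} · 1/(y − ℓ₂(x))`, `[s]` is congruent modulo `KZ.relations` to the subgroup
generated by the literal class `GG 1 2 1` (`RebasePos.good_par_one`: product-cell dissection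
`rebaseSimplePos_par_cells` + `rebaseSimplePos_par_cell_one` on each cell). With W9's
double-corner bands this closes `stub_rebaseSimplePosOneZero` through
`rebaseSimplePos_oneFibre_of_double'`. -/
theorem rebaseSimplePos_par_one (m : ℕ) (L : Fin m → (Fin 1 → ℚ) × ℚ) (e : Fin m → ℕ) (ℓ₁ ℓ₂ : (Fin 1 → ℚ) × ℚ) (m' : ℕ) (s : KZ.IntegralRep (1 + 1 + 1)) (M : Fin m' → (Fin (1 + 1) → ℚ) × ℚ) (p : MvPolynomial (Fin 1) ℚ) (u v : (Fin (1 + 1) → ℚ) × ℚ) (hbd : Bornology.IsBounded s.domain) (hdom : s.domain = SeparatePos.gDom 1 1 m' M (fun _ => Sum.inr u) (fun _ => Sum.inr v)) (hint : Set.EqOn s.integrand (RebasePos.glit 1 1 p L e ℓ₁ ℓ₂ 0 1 (fun _ => some 0)) s.domain) (hu : u.1 (Fin.last 1) ≠ 0) (hpar : u.1 (Fin.last 1) = v.1 (Fin.last 1)) (hcell : ∀ z : Fin (1 + 1 + 1) → ℝ, (∀ j, 0 < SeparatePos.affF 1 1 (M j) z) → 0 < SeparatePos.affF 1 1 u z ∧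 SeparatePos.affF 1 1 u z < SeparatePos.affF 1 1 v z) : ∃ c ∈ AddSubgroup.closure (SeparatePos.GGset 1 2 1), KZ.of s - c ∈ KZ.relations :=
  RebasePos.good_par_one L e ℓ₁ ℓ₂ s M p u v hbd hdom hint hu hpar hcell

end Summit.KontsevichZagierPeriods.ArrangementNormalForm.JanusBands
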